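import Summits.QuantumFields.BalabanUV.Beta.GAN24.SoftColumnVertexRate
import Summits.QuantumFields.BalabanUV.Beta.GAN24.ChainLeibnizFour

/-!
# `BalabanUV.Beta.GAN24.SoftColumnVertexRateFour` — binder row G-an2-4 ∕ (CONV-C), route R7 «TWO CURRENCIES», S4 EXECUTED ON TYPED BAŁABAN
# OBJECTS, companion of `GAN24/SoftColumnVertexRate`: the FOUR-column local vertex chain of the `U = 1` soft-minimiser columns (the
# value-level SHAPE of AN1 Table T row T1's `ad*_h ad_{h′}` bracket between two unit-sourced legs) — exact transport under King's staircase
# and the ONE-STEP SUP RATE `θ₁ = L⁻¹` MODULO THE SAME ONE SUP LETTER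

NOT IN PRINT; OUR PROOF ATTEMPT (prover part P3 of row G-an2-4, fibre∕strip («Woodbury») lineage, gen 25; CRUX TEAM (2), ruling «YM
REDIRECT TOWARDS THE SUMMIT», 2026-08-21).  HONEST DEPENDENCY (cell records, verbatim): «continuum YM on T⁴ ⇐ BetaPertH ∧ nine spine
estimates (0/9 proved); BetaPertH ⇐ (D1) ∧ (D4) ∧ CAP+tail; G-an2-4 gates asym, D1 and NE2/3/4.»  HONEST FRAMING (cell contract, verbatim):
«discharging `BetaPertH` makes Bałaban's UV stability UNCONDITIONAL — a real constructive-QFT result; it is NOT the continuum limit and NOT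
the Clay problem.»  ABSOLUTE RULE: nothing printed is a hypothesis; no `def … : Prop`, no sorry; [folklore] algebra over TREE objects BY NAME
(NE2-P1's `BalabanMinimizerLaw.Mtil`∕`Jpc`; see `GAN24/SoftColumnVertexRate` for the objects, the mechanism and the HONEST SCOPE, which apply
verbatim: MODEL chain, SOFT columns, value-level vertices, `U = 1`, CONDITIONAL on the displayed letter `hcol`).

 * `V₄ k c f g h e := n_k^d·vtx₄ c f g h e` (physical normalisation), `vtx₄_Jpc` (`vtx₄ c (Jf)(Jg)(Jh)(Je) = (L^d)⁻¹·vtx₄ c f g h e`),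
   **`V₄_transport`** `V₄ (k+1) c (J f) (J g) (J h) (J e) = V₄ k c f g h e`;
 * **`V₄_col_succ_sub_le`**: under `hcol : ∀ k q X, √(n_k^d)·‖M̃_k X q‖ ≤ C_∞`,
   `‖V₄ (k+1) c [cols_{k+1} p q r o] − V₄ k c [cols_k p q r o]‖ ≤ 4·‖c‖₁·C_∞²·(a·Cst)·(a·CQH)·L^{−k}` — every torus, every `L ≥ 1`, `d`, `a > 0`.

NEVER «G-an2-4 closed»; NOT (CONV-C), NOT (ρ2)(ρ3), NOT D1, NOT BetaPertH, NOT continuum, NOT Clay.  Provenance: prover-b2b-balaban-gan24-p3-g25-0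
(unit `b2b-balaban-gan24-p3`, gen 25), 2026-08-21.
-/

noncomputable section

open scoped BigOperators ComplexConjugate Matrix Matrix.Norms.L2Operator
open Finset

namespace Summit.QuantumFields.BalabanUV.Beta.GAN24.SoftColumnVertexRateFour

open Literature.MathematicalPhysics.QuantumFieldTheory.Balaban1983to89.B5Prop11Plancherel
open Literature.MathematicalPhysics.QuantumFieldTheory.Balaban1983to89.B5Prop11Lower (nsq nsq_nonneg)
open Literature.MathematicalPhysics.QuantumFieldTheory.Balaban1983to89.B5G183RateUnitTower (lev lev_neZero)
open Summit.QuantumFields.BalabanUV.T4Continuum.BalabanAveragedTowerUnit (idx lev_succ' one_le_lev' cast_lev')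
open Summit.QuantumFields.BalabanUV.T4Continuum.BalabanAveragedTowerModes (par)
open Summit.QuantumFields.BalabanUV.T4Continuum.BalabanMinimizerLaw
open Summit.QuantumFields.BalabanUV.Beta.GAN24.ChainLeibniz
open Summit.QuantumFields.BalabanUV.Beta.GAN24.ChainLeibnizFour
open Summit.QuantumFields.BalabanUV.Beta.GAN24.SoftColumnVertexRate

variable {d : ℕ} (L : ℕ) [NeZero L] (M : Fin d → ℕ) [hM : ∀ μ, NeZero (M μ)]

/-- **THE FOUR-COLUMN LOCAL VERTEX FUNCTIONAL at level `k`, physically normalised**: `V₄ k c f g h e = n_k^d·vtx₄ c f g h e` (the SHAPE of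
T1's `ad*_h ad_{h′}` bracket between two legs, `c` = a product of structure constants). [folklore] -/
def V₄ (k : ℕ) {α : Type*} [Fintype α] (c : Fin d → Fin d → Fin d → Fin d → ℂ) (f g h e : α × Fin d → ℂ) : ℂ :=
  ((((L : ℝ) ^ d) ^ k : ℝ) : ℂ) * vtx₄ c f g h e

/-- the un-normalised four-slot transport: `vtx₄ c (Jf) (Jg) (Jh) (Je) = (L^d)⁻¹ · vtx₄ c f g h e`. [folklore] -/
theorem vtx₄_Jpc (k : ℕ) (c : Fin d → Fin d → Fin d → Fin d → ℂ) (f g h e : idx L M k → ℂ) :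
    vtx₄ c (Jpc L M k *ᵥ f) (Jpc L M k *ᵥ g) (Jpc L M k *ᵥ h) (Jpc L M k *ᵥ e) = ((L : ℂ) ^ d)⁻¹ * vtx₄ c f g h e := by
  set s : ℂ := ((Real.sqrt ((L : ℝ) ^ d) : ℝ) : ℂ) with hs_def
  have hs : s ≠ 0 := by rw [hs_def]; exact_mod_cast (Real.sqrt_pos.mpr (pow_pos (by exact_mod_cast Nat.pos_of_ne_zero (NeZero.ne L)) d) : 0 < Real.sqrt ((L : ℝ) ^ d)).ne'
  have hss : s * s = (L : ℂ) ^ d := by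
    rw [hs_def, ← Complex.ofReal_mul, Real.mul_self_sqrt (pow_nonneg (Nat.cast_nonneg _) d)]; push_cast; rfl
  have e1 : vtx₄ c (Jpc L M k *ᵥ f) (Jpc L M k *ᵥ g) (Jpc L M k *ᵥ h) (Jpc L M k *ᵥ e)
      = ∑ x' : Tor (fine (L * lev L k) M), (s⁻¹ * s⁻¹ * (s⁻¹ * s⁻¹)) *
          ∑ i, ∑ j, ∑ l, ∑ o, c i j l o * (f (par (lev L k) L M x', i) * g (par (lev L k) L M x', j) *
            h (par (lev L k) L M x', l) * e (par (lev L k) L M x', o)) := by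
    rw [vtx₄]
    refine Finset.sum_congr rfl fun x' _ => ?_
    simp only [Jpc_mulVec_apply, Finset.mul_sum]
    refine Finset.sum_congr rfl fun i _ => Finset.sum_congr rfl fun j _ => Finset.sum_congr rfl fun l _ =>
      Finset.sum_congr rfl fun o _ => ?_
    rw [← hs_def]; ring
  have e2 : ∑ x' : Tor (fine (L * lev L k) M), (s⁻¹ * s⁻¹ * (s⁻¹ * s⁻¹)) *
          ∑ i, ∑ j, ∑ l, ∑ o, c i j l o * (f (par (lev L k) L M x', i) * g (par (lev L k) L M x', j) *
            h (par (lev L k) L M x', l) * e (par (lev L k) L M x', o))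
      = (s⁻¹ * s⁻¹ * (s⁻¹ * s⁻¹)) * ((L : ℂ) ^ d * vtx₄ c f g h e) := by
    rw [← Finset.mul_sum, vtx₄,
      sum_comp_par L M (lev L k) (fun x => ∑ i, ∑ j, ∑ l, ∑ o, c i j l o * (f (x, i) * g (x, j) * h (x, l) * e (x, o)))]
  rw [e1, e2, ← hss]
  field_simp

/-- **EXACT TRANSPORT OF THE FOUR-COLUMN VERTEX**: `V₄ (k+1) c (J f) (J g) (J h) (J e) = V₄ k c f g h e`. [folklore] -/
theorem V₄_transport (k : ℕ) (c : Fin d → Fin d → Fin d → Fin d → ℂ) (f g h e : idx L M k → ℂ) :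
    V₄ L (k + 1) c (Jpc L M k *ᵥ f) (Jpc L M k *ᵥ g) (Jpc L M k *ᵥ h) (Jpc L M k *ᵥ e) = V₄ L k c f g h e := by
  have hLd : ((L : ℂ) ^ d) ≠ 0 := pow_ne_zero _ (by exact_mod_cast NeZero.ne L)
  rw [V₄, V₄, vtx₄_Jpc, pow_succ, Complex.ofReal_mul]
  push_cast
  calc ((L : ℂ) ^ d) ^ k * (L : ℂ) ^ d * (((L : ℂ) ^ d)⁻¹ * vtx₄ c f g h e)
      = ((L : ℂ) ^ d * ((L : ℂ) ^ d)⁻¹) * (((L : ℂ) ^ d) ^ k * vtx₄ c f g h e) := by ring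
    _ = ((L : ℂ) ^ d) ^ k * vtx₄ c f g h e := by rw [mul_inv_cancel₀ hLd, one_mul]

variable (a : ℝ) (ha : 0 < a)

/-- **THE ONE-STEP SUP RATE OF THE FOUR-COLUMN VERTEX CHAIN (T1's `ad*_h ad_{h′}` SHAPE), MODULO THE SAME SUP LETTER**:
`‖V₄ (k+1) c [cols_{k+1}] − V₄ k c [cols_k]‖ ≤ 4·‖c‖₁·C_∞²·(a·Cst)·(a·CQH)·L^{−k}`. [folklore] -/
theorem V₄_col_succ_sub_le {C : ℝ} (hC : 0 ≤ C)
    (hcol : ∀ (k : ℕ) (q : idx L M 0) (X : idx L M k), Real.sqrt (((L : ℝ) ^ d) ^ k) * ‖Mtil L M a ha k X q‖ ≤ C)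
    (c : Fin d → Fin d → Fin d → Fin d → ℂ) (p q r o : idx L M 0) (k : ℕ) :
    ‖V₄ L (k + 1) c (colS L M a ha k p) (colS L M a ha k q) (colS L M a ha k r) (colS L M a ha k o)
        - V₄ L k c (col L M a ha k p) (col L M a ha k q) (col L M a ha k r) (col L M a ha k o)‖
      ≤ 4 * (cnorm₄ c * (C * C * ((a * Cst d a) * (a * CQH d a * ((L : ℝ)⁻¹) ^ k)))) := by
  have hn : (0 : ℝ) < ((L : ℝ) ^ d) ^ (k + 1) := pow_pos (pow_pos (by exact_mod_cast Nat.pos_of_ne_zero (NeZero.ne L)) d) _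
  have hA : 0 ≤ a * Cst d a := mul_nonneg ha.le (Cst_nonneg d a)
  have hε : 0 ≤ a * CQH d a * ((L : ℝ)⁻¹) ^ k := (norm_nonneg _).trans (opNorm_Mtil_succ_sub_le L M a ha k)
  rw [← V₄_transport L M k c]
  set t : ℝ := Real.sqrt (((L : ℝ) ^ d) ^ (k + 1)) with ht_def
  have ht : 0 < t := sqrt_pow_pos (d := d) L (k + 1)
  have htt : ((L : ℝ) ^ d) ^ (k + 1) = t * t := (Real.mul_self_sqrt hn.le).symm
  set B : ℝ := C / t with hB_def
  have hB : 0 ≤ B := div_nonneg hC ht.le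
  have hsup' : ∀ (q' : idx L M 0) (z : Tor (fine (L * lev L k) M) × Fin d), ‖colS L M a ha k q' z‖ ≤ B := fun q' z =>
    norm_le_div_of_letter L (fun X => hcol (k + 1) q' X) z
  have hsupJ : ∀ (q' : idx L M 0) (z : Tor (fine (L * lev L k) M) × Fin d), ‖(Jpc L M k *ᵥ col L M a ha k q') z‖ ≤ B := by
    intro q' z
    refine norm_le_div_of_letter L (k := k + 1) (fun X => ?_) z
    rw [sqrt_mul_norm_Jpc_mulVec]
    exact hcol k q' _
  have key := norm_vtx₄_sub_vtx₄_le c (Jpc L M k *ᵥ col L M a ha k p) (Jpc L M k *ᵥ col L M a ha k q)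
    (Jpc L M k *ᵥ col L M a ha k r) (Jpc L M k *ᵥ col L M a ha k o) (colS L M a ha k p) (colS L M a ha k q)
    (colS L M a ha k r) (colS L M a ha k o) hε hA hB
    (nsq_col_step_le L M a ha k p) (nsq_col_step_le L M a ha k q) (nsq_col_step_le L M a ha k r) (nsq_col_step_le L M a ha k o)
    (nsq_Jpc_col_le L M a ha k p) (nsq_colS_le L M a ha k o)
    (hsupJ p) (hsupJ q) (hsupJ r) (hsup' q) (hsup' r) (hsup' o)
  rw [V₄, V₄, ← mul_sub, norm_mul, Complex.norm_real, Real.norm_of_nonneg hn.le]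
  calc ((L : ℝ) ^ d) ^ (k + 1) * ‖vtx₄ c (colS L M a ha k p) (colS L M a ha k q) (colS L M a ha k r)
          (colS L M a ha k o) - vtx₄ c (Jpc L M k *ᵥ col L M a ha k p) (Jpc L M k *ᵥ col L M a ha k q)
          (Jpc L M k *ᵥ col L M a ha k r) (Jpc L M k *ᵥ col L M a ha k o)‖
      ≤ ((L : ℝ) ^ d) ^ (k + 1) * (4 * (cnorm₄ c * (B * B * ((a * Cst d a) * (a * CQH d a * ((L : ℝ)⁻¹) ^ k))))) :=
        mul_le_mul_of_nonneg_left key hn.le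
    _ = 4 * (cnorm₄ c * ((t * B) * (t * B) * ((a * Cst d a) * (a * CQH d a * ((L : ℝ)⁻¹) ^ k)))) := by
        rw [htt]; ring
    _ = 4 * (cnorm₄ c * (C * C * ((a * Cst d a) * (a * CQH d a * ((L : ℝ)⁻¹) ^ k)))) := by
        rw [hB_def, mul_div_cancel₀ _ ht.ne']

end Summit.QuantumFields.BalabanUV.Beta.GAN24.SoftColumnVertexRateFour

end
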